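import Mathlib
import Summits.HubbardSuperconductivity.HubbardSuperconductivity.Theses.BalabanIR
import Summits.HubbardSuperconductivity.HubbardSuperconductivity.Theorems.BalabanIRBirGappedPhaseReductionRLogic
import Literature.MathematicalPhysics.QuantumLattice.DuhamelTwoPoint
import Literature.MathematicalPhysics.QuantumLattice.FinDimSpectrum
import Literature.MathematicalPhysics.QuantumLattice.HubbardModel
import Literature.MathematicalPhysics.QuantumLattice.PairCorrelations

/-!
# Sketch — crux-ideate round 1, ideator 2, crux `stmt-HubbardSuperconductivity-14846`
(`BalabanIR.BirGappedPhaseReductionR := BirComplexStableXYR → BirBdGPhaseCoercivity → BirGroundStateAverageLRO`)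

First lemmas of the three idea cards (statements only; they must ELABORATE, not be proved):

* §A  card `form-factor-hs-ward-transfer` — `hsWardStatic` (static Hubbard–Stratonovich Gaussian
  integration-by-parts identity for matrices; numerically verified to 1e-12, kit j015377 Toy A) and the typed
  transfer target `SectorDuhamelPairOrder` (frequent-in-β canonical-sector DUHAMEL d-wave pair order) with the
  composition `reductionR_of_sectorDuhamelPairOrder` (sorried: Duhamel → equal-time is DLS (25) + the O(L²)
  commutator `[Δ_d, Δ_d†]`, then the landed closer `birGappedPhaseReductionR_of_frequently_thermal`).
* §B  card `chirality-sheet-peierls` — `BdGChiralityWallCoercivity` (static d+id / d−id wall cost, sibling of crux 3;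
  kit j015377 Toy B: positive at every tested texture, worst case ≈ Δ₂² log per frustrated diagonal bond,
  isolated straight walls ≈ 0.27·Δ₁ per unit length at Δ₂ = 0.625 Δ₁, μ = −1).
* §C  card `landau-trichotomy-face-lemma` — `BdGBlockFaceCoercivity` (crux 3's inequality RESTRICTED to
  b-block-constant textures with bΔ ≤ 1 has a constant LINEAR in Δ; kit j015377: sharp π phase wall costs
  0.49 / 0.27 / 0.13 / 0.06 per unit length at Δ₁ = 0.4 / 0.2 / 0.1 / 0.05, i.e. ≈ 1.2 Δ₁, against crux 3's
  worst-case 2c₀ ≈ Δ₁² log(1/Δ₁)).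
-/

noncomputable section

namespace Summit.HubbardSuperconductivity.HubbardSuperconductivity.Cruxes.BirGappedPhaseReductionR.Ideator2

open scoped BigOperators ComplexConjugate Matrix
open MeasureTheory Complex Set Filter
open Literature.Probability.LatticeModels Literature.MathematicalPhysics.QuantumLattice
open Summit.HubbardSuperconductivity.HubbardSuperconductivity.Theses.BalabanIR

/-! ## §A  Static HS Ward identity and the Duhamel transfer target -/

/-- **Static Hubbard–Stratonovich Ward identity (first lemma of card A).** For a Hermitian `H`, an arbitrary
matrix `X` (the pair bilinear), `β, g > 0`, with the sourced Hamiltonian `H_φ = H − φ̄ X − φ Xᴴ` (Hermitian),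
`Φ(φ) = Re tr e^{−βH_φ}`, Gaussian weight `w(φ) = e^{−(β/g)|φ|²}` and the sourced Duhamel pair correlator
`D(φ) = β² ∫₀¹ Re tr(X e^{−(1−u)βH_φ} Xᴴ e^{−uβH_φ}) du = ∂_φ∂_φ̄ Φ`, complex Gaussian integration by parts
(twice) gives `∫ |φ|² w Φ = (g/β) ∫ w Φ + (g/β)² ∫ w D` — "HS-field second moment = g/β + g²·(field-averaged
Duhamel pair correlator)": the transfer from the field to the fermion pair functional is an IDENTITY.
(Integration over `ℂ ≅ ℝ²` written in real coordinates.) [folklore] -/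
def HsWardStatic : Prop :=
  ∀ {n : Type} [Fintype n] [DecidableEq n] (H X : Matrix n n ℂ), H.IsHermitian → ∀ (β g : ℝ), 0 < β → 0 < g →
    let Hs : ℝ × ℝ → Matrix n n ℂ := fun p =>
      H - (starRingEnd ℂ ((p.1 : ℂ) + (p.2 : ℂ) * I)) • X - ((p.1 : ℂ) + (p.2 : ℂ) * I) • Xᴴ
    let Φ : ℝ × ℝ → ℝ := fun p => (Matrix.partitionFn β (Hs p)).re
    let w : ℝ × ℝ → ℝ := fun p => Real.exp (-(β / g) * (p.1 ^ 2 + p.2 ^ 2))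
    let D : ℝ × ℝ → ℝ := fun p => β ^ 2 * ∫ u in (0:ℝ)..1,
      (X * Matrix.gibbsWeight ((1 - u) * β) (Hs p) * Xᴴ * Matrix.gibbsWeight (u * β) (Hs p)).trace.re
    ∫ p : ℝ × ℝ, (p.1 ^ 2 + p.2 ^ 2) * w p * Φ p =
      (g / β) * ∫ p : ℝ × ℝ, w p * Φ p + (g / β) ^ 2 * ∫ p : ℝ × ℝ, w p * D p

/-- **Typed transfer target of card A (C⁺_A): frequent-in-β canonical-sector DUHAMEL `d`-wave pair order.**
For some `δ ∈ (0,1/2)`, a window `(U₁,U₂) ⊂ (0,∞)` and `c > 0`: for every `U` in the window, eventually in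
even `L`, on an unbounded set of `β`, the `(N_L, S^z=0)`-sector Duhamel two-point function of the summit's pair
field, `Z_S⁻¹ ∫₀¹ Re tr(P_S Δ_dᴴ e^{−sβH} Δ_d e^{−(1−s)βH}) ds`, is `≥ c L⁴` (`Δ_d = pairField dWaveFormFactor L`,
`H = hubbardTorus 2 L 1 U`, `P_S` the sector projection, `Z_S = Re tr(P_S e^{−βH})`).  By the HS Ward identity
this number IS the zero-mode occupation `(⟨|φ₀|²⟩ − g/β)/g²` of the B1g Hubbard–Stratonovich field of the
add-and-subtract decoupling `−g Σ_{|q|<q₀} Δ_d(q)ᴴ Δ_d(q)` (card A), i.e. exactly the magnetisation functional a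
low-temperature expansion of the field measure bounds. [folklore] -/
def SectorDuhamelPairOrder : Prop :=
  ∃ δ ∈ Set.Ioo (0:ℝ) (1/2), ∃ U₁ U₂ c : ℝ, 0 < U₁ ∧ U₁ < U₂ ∧ 0 < c ∧
    ∀ U ∈ Set.Ioo U₁ U₂, ∃ L₀ : ℕ, ∀ (L : ℕ) [NeZero L], L₀ ≤ L → Even L →
      let N : ℕ := 2 * ⌊(1 - δ) * (L : ℝ) ^ 2 / 2⌋₊
      let H := hubbardTorus 2 L 1 U
      let S := szSector (Λ := FermionTorus 2 L) N 0
      let PS := projMatrix (S.map (Fock.toEuclidean (ι := Orb (FermionTorus 2 L)) :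
        Fock (Orb (FermionTorus 2 L)) →ₗ[ℂ] EuclideanSpace ℂ (Finset (Orb (FermionTorus 2 L)))))
      let Δ := pairField dWaveFormFactor L
      ∃ᶠ β : ℝ in atTop, c * (L : ℝ) ^ 4 ≤
        (∫ s in (0:ℝ)..1, (PS * Δᴴ * Matrix.gibbsWeight (s * β) H * Δ *
            Matrix.gibbsWeight ((1 - s) * β) H).trace.re) / (PS * Matrix.gibbsWeight β H).trace.re

/-- **The uniform commutator bound used in the Duhamel → equal-time step** (DLS 1978 (25):
`½⟨AᴴA + AAᴴ⟩ ≥ (A,A)_Duhamel`, hence `⟨Δ_dᴴΔ_d⟩ ≥ (Δ_d,Δ_d)_Duh − ½‖[Δ_d, Δ_dᴴ]‖`): the commutator of the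
summit's pair field with its adjoint is a one-body operator of norm `≤ C L²`. [folklore] -/
def PairFieldCommutatorBound : Prop :=
  ∃ C : ℝ, ∀ (L : ℕ) [NeZero L],
    ‖(Matrix.toEuclideanCLM (n := Finset (Orb (FermionTorus 2 L))) (𝕜 := ℂ))
        (pairField dWaveFormFactor L * (pairField dWaveFormFactor L)ᴴ -
          (pairField dWaveFormFactor L)ᴴ * pairField dWaveFormFactor L)‖ ≤ C * (L : ℝ) ^ 2

/-- **Composition to the crux BY NAME (card A).** Sector Duhamel pair order (C⁺_A) and the commutator bound give
the frequent thermal EQUAL-TIME bound (DLS (25) in the sector: `P_S` commutes with `H`, `Δ_dᴴΔ_d`, so the sector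
Gibbs functional is a state on the compressed algebra), and the landed closer
`Theorems.birGappedPhaseReductionR_of_frequently_thermal` concludes `BirGappedPhaseReductionR` — with `h2R`
inert (landed `Negative.NoExactFiniteTable.cexp_ne_affine_cos`) and `h3` consumed inside the proof of C⁺_A. -/
theorem reductionR_of_sectorDuhamelPairOrder
    (hA : SectorDuhamelPairOrder) (hC : PairFieldCommutatorBound) : BirGappedPhaseReductionR := by
  sorry

/-! ## §B  Static chirality-wall coercivity for the d+id reference (first lemma of card B) -/

/-- The BdG bond data of crux 3, with a phase texture `θ` AND a chirality texture `σ : Λ → Bool`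
(`σ x = true` ↦ local d+id, `false` ↦ local d−id): the `d_xy` (diagonal-bond) amplitude carries the bond
average `(s_x + s_y)/2`, `s = ±1`, so a diagonal bond with `σ x ≠ σ y` has NO `d_xy` pairing. [folklore] -/
def bdgHb (L : ℕ) [NeZero L] (μ Δ₁ Δ₂ : ℝ) (θ : TorusSite 2 L → ℝ) (σ : TorusSite 2 L → Bool) :
    Matrix (TorusSite 2 L ⊕ TorusSite 2 L) (TorusSite 2 L ⊕ TorusSite 2 L) ℂ :=
  let nnx : TorusSite 2 L → TorusSite 2 L → Prop := fun x y => y = x + ![1, 0] ∨ y = x + ![-1, 0]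
  let nny : TorusSite 2 L → TorusSite 2 L → Prop := fun x y => y = x + ![0, 1] ∨ y = x + ![0, -1]
  let dg1 : TorusSite 2 L → TorusSite 2 L → Prop := fun x y => y = x + ![1, 1] ∨ y = x + ![-1, -1]
  let dg2 : TorusSite 2 L → TorusSite 2 L → Prop := fun x y => y = x + ![1, -1] ∨ y = x + ![-1, 1]
  let s : TorusSite 2 L → ℂ := fun x => if σ x then 1 else -1
  let h : Matrix (TorusSite 2 L) (TorusSite 2 L) ℂ := fun x y =>
    -(if nnx x y ∨ nny x y then (1 : ℂ) else 0) - (if x = y then (μ : ℂ) else 0)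
  let D : Matrix (TorusSite 2 L) (TorusSite 2 L) ℂ := fun x y =>
    ((Δ₁ : ℂ) * ((if nnx x y then (1 : ℂ) else 0) - (if nny x y then (1 : ℂ) else 0)) +
        Complex.I * (Δ₂ : ℂ) * ((if dg1 x y then (1 : ℂ) else 0) - (if dg2 x y then (1 : ℂ) else 0)) *
          ((s x + s y) / 2)) *
      (Complex.exp (Complex.I * (θ x : ℂ)) + Complex.exp (Complex.I * (θ y : ℂ))) / 2
  Matrix.fromBlocks h D Dᴴ (-h)

/-- number of FRUSTRATED diagonal bonds (ordered pairs) of a chirality texture. [folklore] -/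
def frustratedDiagonals (L : ℕ) [NeZero L] (σ : TorusSite 2 L → Bool) : ℕ :=
  ((Finset.univ : Finset (TorusSite 2 L × TorusSite 2 L)).filter fun p =>
    (p.2 = p.1 + ![1, 1] ∨ p.2 = p.1 + ![-1, -1] ∨ p.2 = p.1 + ![1, -1] ∨ p.2 = p.1 + ![-1, 1]) ∧ σ p.1 ≠ σ p.2).card

/-- **Static chirality-wall coercivity (first lemma of card B; sibling of crux 3 `BirBdGPhaseCoercivity`).**
In the chiral window the quasi-free energy `−½Σ|λ(Hb)|` of ANY chirality texture exceeds that of the uniform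
d+id state by `c_w · #(frustrated diagonal bonds)`, uniformly in `L` (at zero phase texture).  Expected scale
(kit j015377): worst case `c_w ≈ Δ₂² log(1/Δ)` (width-1 stripes ≡ pure `d_{x²−y²}`), isolated straight walls
`≈ 0.27 Δ₁` per unit length.  It is the modulus input of the sheet-Peierls step that integrates the Z₂ (d±id)
field out of the Hubbard phase marginal BEFORE any U(1) engine is invoked. [folklore] -/
def BdGChiralityWallCoercivity : Prop :=
  ∀ (μ Δ₁ Δ₂ : ℝ), μ ∈ Set.Ioo (-4:ℝ) 4 → Δ₁ ≠ 0 → Δ₂ ≠ 0 → ∃ c_w : ℝ, 0 < c_w ∧ ∃ L₀ : ℕ,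
    ∀ (L : ℕ) [NeZero L], L₀ ≤ L → ∀ σ : TorusSite 2 L → Bool,
      ∀ (hσ : (bdgHb L μ Δ₁ Δ₂ (fun _ => 0) σ).IsHermitian)
        (h0 : (bdgHb L μ Δ₁ Δ₂ (fun _ => 0) (fun _ => true)).IsHermitian),
        c_w * (frustratedDiagonals L σ : ℝ) ≤ ∑ i, |h0.eigenvalues i| - ∑ i, |hσ.eigenvalues i|

/-! ## §C  Block-face coercivity at the Andreev scale (first lemma of card C) -/

/-- `θ` is LAMINAR and `b`-block-constant: `θ x` depends only on `⌊x₀/b⌋` (representatives in `[0, L)`), i.e.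
the texture is constant on vertical strips of width `b` — the geometry in which Fourier transform along `x₁` reduces
the BdG matrix to `L` decoupled one-dimensional BdG chains (one per transverse channel `k₁`), each with a
`b`-block-constant phase texture: the Andreev/Jackiw–Rebbi channel decomposition of card C. [folklore] -/
def IsLaminarBlockConstant (L b : ℕ) [NeZero L] (θ : TorusSite 2 L → ℝ) : Prop :=
  ∀ x y : TorusSite 2 L, (x 0).val / b = (y 0).val / b → θ x = θ y

/-- **Block-face coercivity, LINEAR in Δ (first lemma of card C).** Crux 3's lattice inequality
`Σ|λ(Hb(0))| − Σ|λ(Hb(θ))| ≥ c₀ Σ_{⟨xy⟩}(1 − cos(θ_x − θ_y))` RESTRICTED to laminar `b`-block-constant phase textures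
(constant on vertical strips of width `b`) with `b·(|Δ₁|+|Δ₂|) ≤ 1` (strips not wider than the pair size) holds with a constant `c·(|Δ₁|+|Δ₂|)` whose prefactor
`c` does NOT degrade as `Δ → 0` (Andreev/Josephson scale: a sharp phase step across a face of `b` bonds is
carried by `~k_F b/π` sub-gap channels, each costing `~Δ(1 − |cos(α/2)|)`), whereas the unrestricted constant is
condensation-scale `c₀ ≲ Δ² log(1/Δ)` (Theorems…BdGPhaseCoercivityCeiling `birBdG_constant_le`).  kit j015377:
π-wall cost per unit length 0.49/0.27/0.13/0.06 at Δ₁ = 0.4/0.2/0.1/0.05 (μ = −1, Δ₂ = 0.625Δ₁). [folklore] -/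
def BdGBlockFaceCoercivity : Prop :=
  ∀ μ : ℝ, μ ∈ Set.Ioo (-4:ℝ) 4 → ∃ c : ℝ, 0 < c ∧ ∃ Δ₀ : ℝ, 0 < Δ₀ ∧
    ∀ (Δ₁ Δ₂ : ℝ), Δ₁ ≠ 0 → Δ₂ ≠ 0 → |Δ₁| ≤ Δ₀ → |Δ₂| ≤ Δ₀ →
      ∀ b : ℕ, 1 ≤ b → (b : ℝ) * (|Δ₁| + |Δ₂|) ≤ 1 → ∃ L₀ : ℕ, ∀ (L : ℕ) [NeZero L], L₀ ≤ L → b ∣ L →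
        ∀ θ : TorusSite 2 L → ℝ, IsLaminarBlockConstant L b θ →
          ∀ (hθ : (bdgHb L μ Δ₁ Δ₂ θ (fun _ => true)).IsHermitian)
            (h0 : (bdgHb L μ Δ₁ Δ₂ (fun _ => 0) (fun _ => true)).IsHermitian),
            c * (|Δ₁| + |Δ₂|) * ∑ x : TorusSite 2 L, ∑ y : TorusSite 2 L,
                (if (y = x + ![1, 0] ∨ y = x + ![-1, 0] ∨ y = x + ![0, 1] ∨ y = x + ![0, -1])
                  then (1 - Real.cos (θ x - θ y)) else 0)
              ≤ ∑ i, |h0.eigenvalues i| - ∑ i, |hθ.eigenvalues i|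

/-- Sanity: at `σ ≡ true` the textured BdG matrix of §B/§C is crux 3's `Hb θ` (same `h`, same `D(θ)`), so
§C is literally a restriction-with-better-constant of `BirBdGPhaseCoercivity` and §B its Z₂ sibling.
(Statement-level remark; the definitional unfolding is left to crux-plan.) -/
example : True := trivial

end Summit.HubbardSuperconductivity.HubbardSuperconductivity.Cruxes.BirGappedPhaseReductionR.Ideator2
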